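import Literature.Computability.AlgebraicComplexity.LRTorusWeights
import Literature.Computability.AlgebraicComplexity.LR21CanonicalSubspaces
import HarnessLib

/-!
# Landsberg–Ressayre, Thm. 2.1 — torus weights of the two-sided canonical subspaces (LR17 §6)

Topic `Literature/Computability/AlgebraicComplexity`.  Continues `LR21CanonicalSubspaces.lean`
(two-sided canonical subspaces `𝒫_S = canon₂ Λ A S`, `S ⊆ [m] ⊔ [m]`, of the pencil
`Ã = Λ + Σ x_{kj} A_{kj}`) in the bottom-up proof of `lr_full_equivariant_lower` (LR17 Thm. 2.1,
lower bound), and is the two-sided companion of `LRTorusWeights.lean` (LR17 Thm. 2.8).  In LR17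
the torus `T(E) × T(F)` is lifted to a central torus of a reductive group and `ℂⁿ` is decomposed
into weight spaces; here ONE generic torus element `diag(p_1, …, p_m) ⊗ diag(q_1, …, q_m)`
(`p_i, q_j` pairwise distinct primes, packaged as an injective family `r` on `Fin m ⊕ Fin m`) and ONE
exact lift `(B, C)` of it (`B Λ = Λ C`, `B A_{kj} = p_k q_j A_{kj} C`) are used, and the weight
spaces are the generalised eigenspaces `E β` of `B` (target) and `F γ` of `C` (source):

* `TorusData₂`: the datum (`Λ`, `A`, primes `r`, the lift, the eigenvalue `γ₀ ≠ 0` of `C` on the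
  line `ker Λ`);
* exponents `w ∈ ℕ^{[m] ⊔ [m]}`, their supports `supp₂ w`, the step `st k j = e_{inl k} + e_{inr j}`
  of the variable `x_{kj}`, and the weights `wt w = γ₀ · ∏ r_x^{w_x}`, injective in `w` (unique
  factorisation), with `A_{kj} (F (wt w)) ⊆ E (wt (w + st k j))`, `Λ (F γ) ⊆ E γ`;
* the comparison spaces `Z S' w` and one step of LR's chain inside them (`map_comap_Z_le`), used
  in `LR21CanonicalWeights.lean` to locate the weights of the `𝒫_S`.

The eigenspace toolkit (`eq_iSup_inf_maxGen`, `iSup_inf_maxGen_le`, …) is the one of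
`LRTorusWeights.lean`.

## References

* J. M. Landsberg, N. Ressayre, *Permanent v. determinant: an exponential lower bound assuming
  symmetry and a potential path towards Valiant's conjecture*, Differential Geom. Appl. 55 (2017)
  146–166, arXiv:1508.05788, §6 (proofs of Thm. 2.8 and, "very similar", Thm. 2.1).
-/

noncomputable section

namespace Literature.Computability.AlgebraicComplexity

namespace LRPencil

open Submodule Module.End Finset

variable {V : Type*} [AddCommGroup V] [Module ℂ V] {m : ℕ}

/-! ### Unique factorisation for a finite injective family of primes -/

section UF

/-- Unique factorisation: for an injective family of primes indexed by a finite type,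
`∏ r_x^{a_x}` determines `a` (the `Fin m`-indexed case is `TorusGrading.eq_of_prod_prime_pow_eq`).
[folklore] -/
theorem eq_of_prod_prime_pow_eq_fintype {ι : Type*} [Fintype ι] {r : ι → ℕ}
    (hr : ∀ x, (r x).Prime) (hinj : Function.Injective r) {a b : ι → ℕ}
    (h : ∏ x, r x ^ a x = ∏ x, r x ^ b x) : a = b := by
  classical
  have key : ∀ (a : ι → ℕ) (y : ι), (∏ x, r x ^ a x).factorization (r y) = a y := by
    intro a y
    rw [Nat.factorization_prod fun x _ => pow_ne_zero _ (hr x).ne_zero, Finsupp.finsetSum_apply]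
    simp only [Nat.factorization_pow, Finsupp.smul_apply, smul_eq_mul]
    rw [sum_eq_single y]
    · rw [(hr y).factorization, Finsupp.single_eq_same, mul_one]
    · intro x _ hxy
      rw [(hr x).factorization, Finsupp.single_apply, if_neg (hinj.ne hxy), mul_zero]
    · simp
  funext y
  rw [← key a y, ← key b y, h]

end UF

/-! ### Exponents on `[m] ⊔ [m]`, supports, steps -/

section Supp

/-- The support of an exponent `w ∈ ℕ^{[m] ⊔ [m]}` (rows `inl`, columns `inr`; LR17 §6: the
length of a weight counts its non-zero coordinates). [cite: LandsbergRessayre2017, §6] -/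
def supp₂ (w : Fin m ⊕ Fin m → ℕ) : Finset (Fin m ⊕ Fin m) := univ.filter fun x => w x ≠ 0

/-- The admissible exponents for the index set `S`: `w ≠ 0` with `supp₂ w ⊆ S`. [folklore] -/
def U₂ (S : Finset (Fin m ⊕ Fin m)) : Set (Fin m ⊕ Fin m → ℕ) := {w | w ≠ 0 ∧ supp₂ w ⊆ S}

/-- The step `e_{inl k} + e_{inr j}` by which the variable `x_{kj}` raises exponents (its weight
under `diag(p) ⊗ diag(q)` is `p_k q_j`). [cite: LandsbergRessayre2017, §6] -/
def st (k j : Fin m) : Fin m ⊕ Fin m → ℕ := Pi.single (Sum.inl k) 1 + Pi.single (Sum.inr j) 1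

/-- Membership in the support. [folklore] -/
@[simp] theorem mem_supp₂ (w : Fin m ⊕ Fin m → ℕ) (x : Fin m ⊕ Fin m) : x ∈ supp₂ w ↔ w x ≠ 0 := by
  simp [supp₂]

/-- `supp₂ w = ∅ ↔ w = 0`. [folklore] -/
theorem supp₂_eq_empty_iff (w : Fin m ⊕ Fin m → ℕ) : supp₂ w = ∅ ↔ w = 0 := by
  simp only [supp₂, filter_eq_empty_iff, mem_univ, true_implies, not_not]
  exact ⟨fun h => funext h, fun h i => by rw [h]; rfl⟩

/-- Values of the step vector. [folklore] -/
theorem st_apply (k j : Fin m) (x : Fin m ⊕ Fin m) :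
    st k j x = (if x = Sum.inl k then 1 else 0) + if x = Sum.inr j then 1 else 0 := by
  simp only [st, Pi.add_apply, Pi.single_apply]

/-- `st k j (inl k) = 1`. [folklore] -/
@[simp] theorem st_apply_inl (k j : Fin m) : st k j (Sum.inl k) = 1 := by
  simp [st_apply]

/-- `st k j (inr j) = 1`. [folklore] -/
@[simp] theorem st_apply_inr (k j : Fin m) : st k j (Sum.inr j) = 1 := by
  simp [st_apply]

/-- `st k j` vanishes off `{inl k, inr j}`. [folklore] -/
theorem st_apply_of_ne {k j : Fin m} {x : Fin m ⊕ Fin m} (hk : x ≠ Sum.inl k) (hj : x ≠ Sum.inr j) :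
    st k j x = 0 := by
  simp [st_apply, hk, hj]

/-- `supp₂ (w + st k j) = insert (inl k) (insert (inr j) (supp₂ w))`. [folklore] -/
theorem supp₂_add_st (w : Fin m ⊕ Fin m → ℕ) (k j : Fin m) :
    supp₂ (w + st k j) = insert (Sum.inl k) (insert (Sum.inr j) (supp₂ w)) := by
  ext x
  simp only [mem_supp₂, Pi.add_apply, mem_insert]
  by_cases hk : x = Sum.inl k
  · subst hk; simp
  · by_cases hj : x = Sum.inr j
    · subst hj; simp
    · simp [st_apply_of_ne hk hj, hk, hj]

/-- `w + st k j ∈ U₂ S` when `supp₂ w ⊆ S` and `inl k, inr j ∈ S`. [folklore] -/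
theorem add_st_mem_U₂ {S : Finset (Fin m ⊕ Fin m)} {w : Fin m ⊕ Fin m → ℕ} (hw : supp₂ w ⊆ S)
    {k j : Fin m} (hk : Sum.inl k ∈ S) (hj : Sum.inr j ∈ S) : w + st k j ∈ U₂ S := by
  refine ⟨fun h => ?_, ?_⟩
  · have := congrFun h (Sum.inl k)
    simp at this
  · rw [supp₂_add_st]; exact insert_subset hk (insert_subset hj hw)

/-- `st k j ∈ U₂ S` for `inl k, inr j ∈ S`. [folklore] -/
theorem st_mem_U₂ {S : Finset (Fin m ⊕ Fin m)} {k j : Fin m} (hk : Sum.inl k ∈ S)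
    (hj : Sum.inr j ∈ S) : (0 : Fin m ⊕ Fin m → ℕ) + st k j ∈ U₂ S :=
  add_st_mem_U₂ (by rw [(supp₂_eq_empty_iff 0).2 rfl]; exact empty_subset _) hk hj

/-- `U₂` is monotone. [folklore] -/
theorem U₂_mono {S S' : Finset (Fin m ⊕ Fin m)} (h : S' ⊆ S) : U₂ S' ⊆ U₂ S :=
  fun _ hw => ⟨hw.1, hw.2.trans h⟩

end Supp

/-! ### The two-sided torus datum -/

/-- The datum of LR17 §6 (two-sided) in elementary form: the pencil (`Λ`, `A_{kj}`), pairwise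
distinct primes `r` on `[m] ⊔ [m]` (`p = r ∘ inl` on the rows, `q = r ∘ inr` on the columns), ONE
exact lift `L = (B, C)` of the torus element `diag(p) ⊗ diag(q)` (`B Λ = Λ C`,
`B A_{kj} = p_k q_j A_{kj} C`), and the eigenvalue `γ₀ ≠ 0` of `C` on `ker Λ` (for a regular
representation `ker Λ` is a `C`-stable line). [cite: LandsbergRessayre2017, §6] -/
structure TorusData₂ (m : ℕ) (V : Type*) [AddCommGroup V] [Module ℂ V] where
  /-- the constant part -/
  Λ : Module.End ℂ V
  /-- the coefficient of the variable `x_{kj}` -/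
  A : Fin m → Fin m → Module.End ℂ V
  /-- the primes: `r (inl k) = p_k` scales row `k`, `r (inr j) = q_j` scales column `j` -/
  r : Fin m ⊕ Fin m → ℕ
  /-- they are primes -/
  prime : ∀ x, (r x).Prime
  /-- and pairwise distinct -/
  r_inj : Function.Injective r
  /-- the lift of `diag(p) ⊗ diag(q)` -/
  L : Lift₂ Λ A 1 1 fun x => (r x : ℂ)
  /-- the eigenvalue of `C` on `ker Λ` -/
  γ₀ : ℂ
  /-- `ker Λ ⊆ F γ₀` -/
  ker_le : LinearMap.ker Λ ≤ Module.End.maxGenEigenspace (L.C : V →ₗ[ℂ] V) γ₀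
  /-- `γ₀ ≠ 0` -/
  γ₀_ne : γ₀ ≠ 0

namespace TorusData₂

variable (D : TorusData₂ m V)

/-- `B` as an endomorphism. [folklore] -/
abbrev B : Module.End ℂ V := (D.L.B : V →ₗ[ℂ] V)

/-- `C` as an endomorphism. [folklore] -/
abbrev C : Module.End ℂ V := (D.L.C : V →ₗ[ℂ] V)

/-- Target weight space `E β` (generalised eigenspace of `B`). [cite: LandsbergRessayre2017, §6] -/
abbrev E (β : ℂ) : Submodule ℂ V := D.B.maxGenEigenspace β

/-- Source weight space `F γ` (generalised eigenspace of `C`). [cite: LandsbergRessayre2017, §6] -/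
abbrev F (γ : ℂ) : Submodule ℂ V := D.C.maxGenEigenspace γ

/-- The weight `wt w = γ₀ · ∏_x r_x^{w_x}` attached to `w ∈ ℕ^{[m] ⊔ [m]}` (LR17 §6: the character
`Σ_k u_k ε_k + Σ_j v_j ε'_j` of `T(E) × T(F)`, shifted by the weight of `ker Λ`).
[cite: LandsbergRessayre2017, §6] -/
def wt (w : Fin m ⊕ Fin m → ℕ) : ℂ := D.γ₀ * ∏ x, (D.r x : ℂ) ^ w x

/-- `wt 0 = γ₀`. [folklore] -/
@[simp] theorem wt_zero : D.wt 0 = D.γ₀ := by simp [wt]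

/-- `r_x ≠ 0` in `ℂ`. [folklore] -/
theorem r_ne_zero (x : Fin m ⊕ Fin m) : (D.r x : ℂ) ≠ 0 := Nat.cast_ne_zero.2 (D.prime x).ne_zero

/-- `wt (w + st k j) = p_k q_j · wt w`. [folklore] -/
theorem wt_add_st (w : Fin m ⊕ Fin m → ℕ) (k j : Fin m) :
    D.wt (w + st k j) = ((D.r (Sum.inl k) : ℂ) * D.r (Sum.inr j)) * D.wt w := by
  classical
  have hne : (Sum.inl k : Fin m ⊕ Fin m) ≠ Sum.inr j := Sum.inl_ne_inr
  have h1 : (∏ x, (D.r x : ℂ) ^ (w + st k j) x) =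
      (∏ x, (D.r x : ℂ) ^ w x) * ((D.r (Sum.inl k) : ℂ) * D.r (Sum.inr j)) := by
    have : (∏ x, (D.r x : ℂ) ^ (w + st k j) x) = ∏ x, ((D.r x : ℂ) ^ w x * (D.r x : ℂ) ^ st k j x) :=
      prod_congr rfl fun x _ => by rw [Pi.add_apply, pow_add]
    rw [this, prod_mul_distrib]
    congr 1
    rw [← Finset.prod_erase_mul _ _ (mem_univ (Sum.inl k)),
      ← Finset.prod_erase_mul _ _ (show Sum.inr j ∈ univ.erase (Sum.inl k) from
        mem_erase.2 ⟨hne.symm, mem_univ _⟩)]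
    rw [prod_eq_one]
    · simp [mul_comm]
    · intro x hx
      have hx1 : x ≠ Sum.inr j := (mem_erase.1 hx).1
      have hx2 : x ≠ Sum.inl k := (mem_erase.1 (mem_erase.1 hx).2).1
      rw [st_apply_of_ne hx2 hx1, pow_zero]
  simp only [wt]
  rw [h1]; ring

/-- `wt` is injective (unique factorisation, `γ₀ ≠ 0`). [folklore] -/
theorem wt_injective : Function.Injective D.wt := by
  intro u v h
  have h' : (∏ x, (D.r x : ℂ) ^ u x) = ∏ x, (D.r x : ℂ) ^ v x := mul_left_cancel₀ D.γ₀_ne h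
  apply eq_of_prod_prime_pow_eq_fintype D.prime D.r_inj
  exact_mod_cast h'

/-! ### Weight shifts -/

/-- `Λ (F γ) ⊆ E γ`. [cite: LandsbergRessayre2017, §6] -/
theorem map_Λ_F_le (γ : ℂ) : (D.F γ).map D.Λ ≤ D.E γ := by
  have h : D.B ∘ₗ D.Λ = (1 : ℂ) • (D.Λ ∘ₗ D.C) := by
    rw [one_smul]; exact D.L.comp_Λ
  simpa using map_maxGenEigenspace_le_of_comp_eq_smul _ _ D.Λ 1 h γ

/-- `A_{kj} (F γ) ⊆ E (p_k q_j γ)`. [cite: LandsbergRessayre2017, §6] -/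
theorem map_A_F_le (k j : Fin m) (γ : ℂ) :
    (D.F γ).map (D.A k j) ≤ D.E (((D.r (Sum.inl k) : ℂ) * D.r (Sum.inr j)) * γ) := by
  have h := D.L.comp_A k j
  simp only [Equiv.Perm.coe_one, id_eq] at h
  exact map_maxGenEigenspace_le_of_comp_eq_smul _ _ (D.A k j) _ h γ

/-- `A_{kj} (F (wt w)) ⊆ E (wt (w + st k j))`. [cite: LandsbergRessayre2017, §6] -/
theorem map_A_F_wt_le (k j : Fin m) (w : Fin m ⊕ Fin m → ℕ) :
    (D.F (D.wt w)).map (D.A k j) ≤ D.E (D.wt (w + st k j)) := by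
  rw [wt_add_st]; exact D.map_A_F_le k j _

/-- `A_{kj} (ker Λ) ⊆ E (wt (st k j))`. [cite: LandsbergRessayre2017, §6] -/
theorem map_A_ker_le (k j : Fin m) :
    (LinearMap.ker D.Λ).map (D.A k j) ≤ D.E (D.wt (0 + st k j)) :=
  (Submodule.map_mono D.ker_le).trans (by simpa using D.map_A_F_wt_le k j 0)

/-- `ker Λ` meets no `F (wt w)` with `w ≠ 0`. [folklore] -/
theorem ker_inf_F_wt_eq_bot {w : Fin m ⊕ Fin m → ℕ} (hw : w ≠ 0) :
    LinearMap.ker D.Λ ⊓ D.F (D.wt w) = ⊥ := by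
  have hne : D.γ₀ ≠ D.wt w := by
    rw [← D.wt_zero]; exact fun h => hw (D.wt_injective h).symm
  rw [eq_bot_iff]
  exact (le_inf (inf_le_left.trans D.ker_le) inf_le_right).trans
    (Module.End.disjoint_genEigenspace D.C hne ⊤ ⊤).le_bot

/-- `E β` is `B`-stable. [folklore] -/
theorem map_E_le (β : ℂ) : (D.E β).map D.B ≤ D.E β :=
  Submodule.map_le_iff_le_comap.2 fun _ hv =>
    Module.End.mapsTo_maxGenEigenspace_of_comm (Commute.refl D.B) β hv

/-! ### Weights of the canonical subspaces: comparison spaces -/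

/-- The comparison space for `S'`: weight `wt w` carries `𝒫_{S'} ∩ E (wt w)` if `supp₂ w ⊆ S'`
and all of `E (wt w)` otherwise (a bookkeeping device, as in `LRTorusWeights.lean`). [folklore] -/
def Z (S' : Finset (Fin m ⊕ Fin m)) (w : Fin m ⊕ Fin m → ℕ) : Submodule ℂ V :=
  if supp₂ w ⊆ S' then canon₂ D.Λ D.A S' ⊓ D.E (D.wt w) else D.E (D.wt w)

/-- `Z S' w` for `supp₂ w ⊆ S'`. [folklore] -/
theorem Z_eq_of_subset {S' : Finset (Fin m ⊕ Fin m)} {w : Fin m ⊕ Fin m → ℕ} (h : supp₂ w ⊆ S') :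
    D.Z S' w = canon₂ D.Λ D.A S' ⊓ D.E (D.wt w) := if_pos h

/-- `Z S' w` for `supp₂ w ⊄ S'`. [folklore] -/
theorem Z_eq_of_not_subset {S' : Finset (Fin m ⊕ Fin m)} {w : Fin m ⊕ Fin m → ℕ}
    (h : ¬ supp₂ w ⊆ S') : D.Z S' w = D.E (D.wt w) := if_neg h

/-- `Z S' w ⊆ E (wt w)`. [folklore] -/
theorem Z_le_E (S' : Finset (Fin m ⊕ Fin m)) (w : Fin m ⊕ Fin m → ℕ) : D.Z S' w ≤ D.E (D.wt w) := by
  unfold Z; split_ifs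
  · exact inf_le_right
  · exact le_rfl

/-- `Z S' w` is `B`-stable. [folklore] -/
theorem map_Z_le (S' : Finset (Fin m ⊕ Fin m)) (w : Fin m ⊕ Fin m → ℕ) :
    (D.Z S' w).map D.B ≤ D.Z S' w := by
  unfold Z
  split_ifs
  · exact (Submodule.map_inf_le _).trans (inf_le_inf (D.L.map_canon₂_eq_self S').le (D.map_E_le _))
  · exact D.map_E_le _

/-- One step of the chain inside the comparison space:
`A_{kj} (Λ⁻¹ (Z S' w) ∩ F (wt w)) ⊆ Z S' (w + st k j)`. [folklore] -/
theorem map_comap_Z_le (S' : Finset (Fin m ⊕ Fin m)) (k j : Fin m) (w : Fin m ⊕ Fin m → ℕ) :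
    ((D.Z S' w).comap D.Λ ⊓ D.F (D.wt w)).map (D.A k j) ≤ D.Z S' (w + st k j) := by
  have hE : ((D.Z S' w).comap D.Λ ⊓ D.F (D.wt w)).map (D.A k j) ≤ D.E (D.wt (w + st k j)) :=
    (Submodule.map_mono inf_le_right).trans (D.map_A_F_wt_le k j w)
  by_cases h' : supp₂ (w + st k j) ⊆ S'
  · have hw : supp₂ w ⊆ S' := by
      rw [supp₂_add_st] at h'
      exact ((subset_insert _ _).trans (subset_insert _ _)).trans h'
    have hkS' : Sum.inl k ∈ S' := by rw [supp₂_add_st] at h'; exact h' (mem_insert_self _ _)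
    have hjS' : Sum.inr j ∈ S' := by
      rw [supp₂_add_st] at h'; exact h' (mem_insert_of_mem (mem_insert_self _ _))
    rw [D.Z_eq_of_subset h']
    refine le_inf ?_ hE
    calc ((D.Z S' w).comap D.Λ ⊓ D.F (D.wt w)).map (D.A k j)
        ≤ ((canon₂ D.Λ D.A S').comap D.Λ).map (D.A k j) := by
          refine Submodule.map_mono (inf_le_left.trans (Submodule.comap_mono ?_))
          rw [D.Z_eq_of_subset hw]; exact inf_le_left
      _ ≤ canon₂ D.Λ D.A S' := isClosedUnder₂_canon₂ S' k j hkS' hjS'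
  · rw [D.Z_eq_of_not_subset h']
    exact hE

/-- `A_{kj} (ker Λ) ⊆ Z S' (st k j)`. [folklore] -/
theorem map_ker_le_Z (S' : Finset (Fin m ⊕ Fin m)) (k j : Fin m) :
    (LinearMap.ker D.Λ).map (D.A k j) ≤ D.Z S' (0 + st k j) := by
  unfold Z
  split_ifs with h
  · have hk : Sum.inl k ∈ S' := by
      rw [supp₂_add_st] at h; exact h (mem_insert_self _ _)
    have hj : Sum.inr j ∈ S' := by
      rw [supp₂_add_st] at h; exact h (mem_insert_of_mem (mem_insert_self _ _))
    exact le_inf (map_ker_le_canon₂ hk hj) (D.map_A_ker_le k j)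
  · exact D.map_A_ker_le k j

end TorusData₂

end LRPencil

end Literature.Computability.AlgebraicComplexity
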